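import Mathlib.Analysis.Calculus.FDeriv.Equiv
import Mathlib.Analysis.Normed.Operator.LinearIsometry
import Mathlib.MeasureTheory.Measure.Haar.InnerProductSpace
import Mathlib.MeasureTheory.Measure.Lebesgue.EqHaar
import Literature.Analysis.FluidPDE.VectorCalculus
import HarnessLib

/-!
# Steady (stationary) Navier–Stokes solutions on the whole space; Leray's class `D`

Analysis/FluidPDE definitions file (work item `defn-IsSteadyNSSolution`, wanted by the routes
`GaldiLiouvilleGate` / `DSolutionBubble` of `NavierStokesRegularity`, item
`stmt-NavierStokesRegularity-0898`).  A deliberately LIGHT module: it imports only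
`Literature.Analysis.FluidPDE.VectorCalculus` (+ Mathlib) and contains NO named fact, so that route
files can state Liouville-type / `D`-solution items over one debt-free declaration.

Let `E` be a finite-dimensional real inner product space (physical space; `E = ℝ³` in the
literature).

* `IsSteadyNSSolution ν f U P` — classical solutions of the STEADY forced incompressible
  Navier–Stokes system with viscosity `ν` on the whole space,
  `−νΔU + (U·∇)U + ∇P = f`, `div U = 0` pointwise, for `U ∈ C²`, `P ∈ C¹`
  (Wang 2025, (0.1): `−Δu + u·∇u = −∇p`, `∇·u = 0` on `ℝ³` — the case `ν = 1`, `f = 0`; (0.5)₁,₂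
  with a viscosity `μ`; Leray 1933; Galdi 2011, Ch. X).  Same field layout as the tree's
  `IsLerayProfile ν a U P` (`SelfSimilar.lean`), of which it is the case `a = 0` with a force
  (bridge `isLerayProfile_zero_iff` in `SteadyNSSolutionLeray.lean`), and the `C²/C¹` (rather than
  `C^∞`) version of `IsSteadyClassicalNS` (`SteadyStrainedNS.lean`); smoothness `C^∞` is added by
  users as separate hypotheses, exactly as the route items do.
* `IsDSolution ν f U P` — LERAY'S CLASS `D`: a steady solution with finite Dirichlet integral
  `∫ |∇U|² < ∞` (Wang 2025, (0.3) and p. 2 "D-解 (D-solutions)", after Leray 1933; Galdi 2011,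
  Ch. X), the Dirichlet integral being `∫⁻ y, ENNReal.ofReal (frobeniusNormSq (fderiv ℝ U y))`
  (`VectorCalculus.frobeniusNormSq`, `|∇U|² = ∑ᵢⱼ (∂ⱼUᵢ)²`) — literally the expression the route
  items use.  The behaviour at infinity (Wang 2025, (0.2) `u → 0`; (0.5)₄ `u → u₀`) is NOT built
  in: state it as `Tendsto U (cocompact E) (𝓝 U∞)` next to `IsDSolution` where needed
  (`IsDSolution.zero_tendsto` records the shape).
* Proved API: the trivial and constant solutions, linear shear flows (non-vacuity), uniqueness of
  the force, pressure normalisation `P + p₀`, the viscosity normalisation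
  `(ν, U, P, f) ↦ (κν, κU, κ²P, κ²f)`, and the three symmetries of the steady system with the SAME
  viscosity — the Navier–Stokes scaling `U ↦ c U(c ·)`, `P ↦ c² P(c ·)`, `f ↦ c³ f(c ·)`
  (`IsSteadyNSSolution.rescale`; the velocity scaling is letter for letter `nsRescaleData c U` of
  `SelfSimilar.lean`), translations and rotations `U ↦ R U(R⁻¹ ·)` — for both notions
  (`IsDSolution.rescale` needs `c ≠ 0`: `∫|∇U_c|² = |c|^{4−n} ∫|∇U|²`).

## Mathlib / tree search

Mathlib (this pin) has no Navier–Stokes notion (`lean search NavierStokes|IsSteady`: tree only).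
Tree: `IsLerayProfile` (SelfSimilar.lean, imports MildSolution/LerayHopf — outside the allowed
import cone of this file), `IsSteadyClassicalNS` (SteadyStrainedNS.lean, `C^∞`, imports
ClassicalSolution), `Torus.IsSteadyWeakSolution` (StatisticalSolution.lean, periodic weak
solutions).  The pointwise chain rules used below (Laplacian/gradient/divergence under dilations,
translations and isometries; dilation of Lebesgue measure; `|cL|² = c²|L|²`, `|RAR⁻¹|² = |A|²`)
exist in `MildSolutionProofs`, `IsometryInvariance`, `SolenoidalTruncation`, `SpaceTimeRescaling`,
`AxisymmetricTypeIOffAxis` — all outside the allowed import cone — and are re-derived here as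
`private` lemmas from Mathlib (`fderiv_comp_smul`, `ContinuousLinearMap.iteratedFDeriv_comp_right`,
`iteratedFDeriv_comp_add_right`, `laplacian_eq_iteratedFDeriv_orthonormalBasis`,
`Measure.map_addHaar_smul`, `LinearIsometryEquiv.measurePreserving`).

## References

* W. Wang (王文栋), *Liouville theorems for the steady Navier–Stokes equations* (稳态Navier-Stokes方程的
  Liouville定理), Science Press (2025), pp. 1–2: (0.1)–(0.3), (0.5), "D-解". [Wang2025]
* G. P. Galdi, *An Introduction to the Mathematical Theory of the Navier–Stokes Equations:
  Steady-State Problems*, 2nd ed., Springer (2011), Ch. I §I.2 and Ch. X. [Galdi2011]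
* J. Leray, *Étude de diverses équations intégrales non linéaires et de quelques problèmes que pose
  l'hydrodynamique*, J. Math. Pures Appl. 12 (1933) 1–82 (solutions with finite Dirichlet
  integral), as reported in Wang 2025, p. 2.
-/

noncomputable section

open MeasureTheory Filter Set Function Module
open scoped Laplacian InnerProductSpace RealInnerProductSpace ENNReal Topology

namespace Literature.Analysis.FluidPDE

variable {E : Type*} [NormedAddCommGroup E] [InnerProductSpace ℝ E] [FiniteDimensional ℝ E]

/-! ### Pointwise chain rules (private re-derivations, see the module docstring) -/

section Calculus

variable {F : Type*} [NormedAddCommGroup F] [NormedSpace ℝ F]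

omit [FiniteDimensional ℝ E] in
/-- `D(y ↦ c • U(c y))(x) = c² • DU(c x)` for `U` differentiable (chain rule; Mathlib's
`fderiv_comp_smul`). [folklore] -/
private theorem fderiv_rescale_velocity {U : E → F} (hU : Differentiable ℝ U) (c : ℝ) (x : E) :
    fderiv ℝ (fun y => c • U (c • y)) x = c ^ 2 • fderiv ℝ U (c • x) := by
  have hd : DifferentiableAt ℝ (fun y => U (c • y)) x :=
    (hU (c • x)).comp x (differentiableAt_id.const_smul c)
  rw [fderiv_fun_const_smul hd, fderiv_comp_smul c, smul_smul, pow_two]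

/-- `Δ(U(c ·))(x) = c² • (ΔU)(c x)` for `U ∈ C²` (second derivatives pick up `c²`; Mathlib's
`ContinuousLinearMap.iteratedFDeriv_comp_right` and multilinearity). [folklore] -/
private theorem laplacian_comp_smul_right {U : E → F} (hU : ContDiff ℝ 2 U) (c : ℝ) (x : E) :
    (Δ (fun y => U (c • y))) x = c ^ 2 • (Δ U) (c • x) := by
  set b := stdOrthonormalBasis ℝ E
  have hcomp : (fun y => U (c • y)) = U ∘ (c • ContinuousLinearMap.id ℝ E) := by
    funext y; simp
  rw [InnerProductSpace.laplacian_eq_iteratedFDeriv_orthonormalBasis _ b,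
    InnerProductSpace.laplacian_eq_iteratedFDeriv_orthonormalBasis U b]
  simp only [Finset.smul_sum]
  refine Finset.sum_congr rfl fun i _ => ?_
  rw [hcomp, ContinuousLinearMap.iteratedFDeriv_comp_right _ hU x (by norm_cast),
    ContinuousMultilinearMap.compContinuousLinearMap_apply]
  have h2 : (fun j : Fin 2 => (c • ContinuousLinearMap.id ℝ E) (![b i, b i] j)) =
      fun j => (fun _ : Fin 2 => c) j • ![b i, b i] j := by
    funext j; simp
  rw [h2, ContinuousMultilinearMap.map_smul_univ]
  simp [pow_two]

/-- `Δ(U(· + a))(x) = (ΔU)(x + a)` (Mathlib's `iteratedFDeriv_comp_add_right`). [folklore] -/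
private theorem laplacian_comp_add_right' (U : E → F) (a x : E) :
    (Δ (fun y => U (y + a))) x = (Δ U) (x + a) := by
  rw [InnerProductSpace.laplacian_eq_iteratedFDeriv_orthonormalBasis _ (stdOrthonormalBasis ℝ E),
    InnerProductSpace.laplacian_eq_iteratedFDeriv_orthonormalBasis U (stdOrthonormalBasis ℝ E)]
  simp only [iteratedFDeriv_comp_add_right]

omit [FiniteDimensional ℝ E] in
/-- `∇(y ↦ r * P y)(x) = r • ∇P(x)` for `P` differentiable at `x` (Riesz map is linear). [folklore] -/
private theorem gradient_const_mul [CompleteSpace E] {P : E → ℝ} {x : E}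
    (hP : DifferentiableAt ℝ P x) (r : ℝ) :
    gradient (fun y => r * P y) x = r • gradient P x := by
  rw [gradient, fderiv_const_mul hP r, gradient, map_smulₛₗ]
  simp

omit [FiniteDimensional ℝ E] in
/-- `∇(P(c ·))(x) = c • (∇P)(c x)` (chain rule `fderiv_comp_smul`, linearity of the Riesz map). [folklore] -/
private theorem gradient_comp_smul_right [CompleteSpace E] (P : E → ℝ) (c : ℝ) (x : E) :
    gradient (fun y => P (c • y)) x = c • gradient P (c • x) := by
  rw [gradient, fderiv_comp_smul c, gradient, map_smulₛₗ]
  simp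

omit [FiniteDimensional ℝ E] in
/-- `∇(P(· + a))(x) = (∇P)(x + a)`. [folklore] -/
private theorem gradient_comp_add_right' [CompleteSpace E] (P : E → ℝ) (a x : E) :
    gradient (fun y => P (y + a)) x = gradient P (x + a) := by
  rw [gradient, fderiv_comp_add_right, gradient]

omit [FiniteDimensional ℝ E] in
/-- `div (y ↦ c • U(c y))(x) = c² · (div U)(c x)` (trace of `c² DU(cx)`). [folklore] -/
private theorem divergence_rescale_velocity {U : E → E} (hU : Differentiable ℝ U) (c : ℝ) (x : E) :
    VectorCalculus.divergence (fun y => c • U (c • y)) x =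
      c ^ 2 * VectorCalculus.divergence U (c • x) := by
  rw [VectorCalculus.divergence, fderiv_rescale_velocity hU c x, ContinuousLinearMap.toLinearMap_smul,
    map_smul, VectorCalculus.divergence, smul_eq_mul]

omit [FiniteDimensional ℝ E] in
/-- `div (U(· + a))(x) = (div U)(x + a)`. [folklore] -/
private theorem divergence_comp_add_right' (U : E → E) (a x : E) :
    VectorCalculus.divergence (fun y => U (y + a)) x = VectorCalculus.divergence U (x + a) := by
  rw [VectorCalculus.divergence, fderiv_comp_add_right, VectorCalculus.divergence]

variable (R : E ≃ₗᵢ[ℝ] E)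

omit [FiniteDimensional ℝ E] in
/-- Chain rule for composition on the right with a linear isometry:
`D(g ∘ R⁻¹)(x) = Dg(R⁻¹ x) ∘ R⁻¹`. [folklore] -/
private theorem fderiv_comp_isometry_symm (g : E → F) (x : E) :
    fderiv ℝ (fun y => g (R.symm y)) x = (fderiv ℝ g (R.symm x)).comp (R.symm : E →L[ℝ] E) :=
  R.symm.toContinuousLinearEquiv.comp_right_fderiv

omit [FiniteDimensional ℝ E] in
/-- Chain rule for the conjugated field: `D(R ∘ U ∘ R⁻¹)(x) = R ∘ DU(R⁻¹ x) ∘ R⁻¹`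
(Majda–Bertozzi, §1.2, proof of Prop. 1.1). [folklore] -/
private theorem fderiv_conj_isometry (U : E → E) (x : E) :
    fderiv ℝ (fun y => R (U (R.symm y))) x =
      (R : E →L[ℝ] E).comp ((fderiv ℝ U (R.symm x)).comp (R.symm : E →L[ℝ] E)) := by
  have h1 : (fun y => R (U (R.symm y))) = R ∘ (fun y => U (R.symm y)) := rfl
  rw [h1, R.comp_fderiv, fderiv_comp_isometry_symm]

/-- The divergence is rotation invariant: `div (R U R⁻¹)(x) = div U (R⁻¹ x)` (trace of a
conjugate). [folklore] -/
private theorem divergence_conj_isometry (U : E → E) (x : E) :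
    VectorCalculus.divergence (fun y => R (U (R.symm y))) x =
      VectorCalculus.divergence U (R.symm x) := by
  set b := stdOrthonormalBasis ℝ E
  rw [divergence_eq_sum_inner_fderiv (b.map R), divergence_eq_sum_inner_fderiv b,
    fderiv_conj_isometry]
  refine Finset.sum_congr rfl fun i _ => ?_
  simp [LinearIsometryEquiv.inner_map_map]

omit [FiniteDimensional ℝ E] in
/-- The gradient is rotation covariant: `∇(P ∘ R⁻¹)(x) = R (∇P (R⁻¹ x))` (Riesz representation and
`⟪R w, y⟫ = ⟪w, R⁻¹ y⟫`). [folklore] -/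
private theorem gradient_comp_isometry_symm [CompleteSpace E] (P : E → ℝ) (x : E) :
    gradient (fun y => P (R.symm y)) x = R (gradient P (R.symm x)) := by
  refine ext_inner_right ℝ fun y => ?_
  rw [gradient, InnerProductSpace.toDual_symm_apply, fderiv_comp_isometry_symm,
    LinearIsometryEquiv.inner_map_eq_flip, gradient, InnerProductSpace.toDual_symm_apply]
  rfl

/-- The Laplacian is invariant under composition with a linear isometry on the right:
`Δ(U ∘ R⁻¹)(x) = ΔU (R⁻¹ x)` (sum of second derivatives over the orthonormal basis `R⁻¹ b`). [folklore] -/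
private theorem laplacian_comp_isometry_symm (U : E → F) (x : E) :
    (Δ (fun y => U (R.symm y))) x = (Δ U) (R.symm x) := by
  set b := stdOrthonormalBasis ℝ E
  rw [InnerProductSpace.laplacian_eq_iteratedFDeriv_orthonormalBasis _ b,
    InnerProductSpace.laplacian_eq_iteratedFDeriv_orthonormalBasis _ (b.map R.symm)]
  refine Finset.sum_congr rfl fun i _ => ?_
  have h1 : (fun y => U (R.symm y)) = U ∘ R.symm.toContinuousLinearEquiv := rfl
  rw [h1, ← iteratedFDerivWithin_univ, ← iteratedFDerivWithin_univ]
  have h2 := R.symm.toContinuousLinearEquiv.iteratedFDerivWithin_comp_right U uniqueDiffOn_univ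
    (x := x) (mem_univ _) 2
  rw [preimage_univ] at h2
  rw [h2, ContinuousMultilinearMap.compContinuousLinearMap_apply]
  congr 1
  funext j
  fin_cases j <;> simp

/-- The Laplacian is rotation covariant on vector fields: `Δ(R U R⁻¹)(x) = R (ΔU (R⁻¹ x))`. [folklore] -/
private theorem laplacian_conj_isometry (U : E → E) (x : E) :
    (Δ (fun y => R (U (R.symm y)))) x = R ((Δ U) (R.symm x)) := by
  have h1 : (fun y => R (U (R.symm y))) = R.toContinuousLinearEquiv ∘ (fun y => U (R.symm y)) :=
    rfl
  rw [h1, InnerProductSpace.laplacian_CLE_comp_left, Function.comp_apply,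
    laplacian_comp_isometry_symm]
  rfl

/-- The Frobenius norm is quadratic: `|c L|² = c² |L|²`. [folklore] -/
private theorem frobeniusNormSq_smul' {F' : Type*} [NormedAddCommGroup F'] [InnerProductSpace ℝ F']
    (c : ℝ) (L : E →L[ℝ] F') : frobeniusNormSq (c • L) = c ^ 2 * frobeniusNormSq L := by
  unfold frobeniusNormSq
  rw [Finset.mul_sum]
  refine Finset.sum_congr rfl fun i _ => ?_
  rw [_root_.smul_apply, norm_smul, mul_pow, Real.norm_eq_abs, sq_abs]

/-- The Frobenius norm is invariant under conjugation by a linear isometry: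
`|R ∘ A ∘ R⁻¹|² = |A|²` (sum over the orthonormal basis `R b`). [folklore] -/
private theorem frobeniusNormSq_conj_isometry (A : E →L[ℝ] E) :
    frobeniusNormSq ((R : E →L[ℝ] E).comp (A.comp (R.symm : E →L[ℝ] E))) = frobeniusNormSq A := by
  rw [frobeniusNormSq_eq_sum ((stdOrthonormalBasis ℝ E).map R),
    frobeniusNormSq_eq_sum (stdOrthonormalBasis ℝ E)]
  refine Finset.sum_congr rfl fun i _ => ?_
  simp [OrthonormalBasis.map_apply]

/-- **Lebesgue measure under dilations**, lower-integral form: `∫ g(c x) dx = |c|^{-n} ∫ g` for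
`c ≠ 0`, `n = dim E` (Mathlib's `Measure.map_addHaar_smul`). [folklore] -/
private theorem lintegral_comp_smul' [MeasurableSpace E] [BorelSpace E] (g : E → ℝ≥0∞) {c : ℝ}
    (hc : c ≠ 0) :
    ∫⁻ x, g (c • x) = ENNReal.ofReal |(c ^ finrank ℝ E)⁻¹| * ∫⁻ y, g y := by
  calc ∫⁻ x, g (c • x) = ∫⁻ y, g y ∂(Measure.map (fun x : E => c • x) volume) :=
        (lintegral_map_equiv g
          (Homeomorph.smul (isUnit_iff_ne_zero.2 hc).unit).toMeasurableEquiv).symm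
    _ = ENNReal.ofReal |(c ^ finrank ℝ E)⁻¹| * ∫⁻ y, g y := by
        rw [Measure.map_addHaar_smul volume hc, lintegral_smul_measure, smul_eq_mul]

end Calculus

/-! ### Steady Navier–Stokes solutions -/

/-- **Steady (stationary) classical solutions of the forced incompressible Navier–Stokes system**
with viscosity `ν` on the whole space `E`: a velocity `U : E → E` of class `C²` and a pressure
`P : E → ℝ` of class `C¹` with
`−νΔU + (U·∇)U + ∇P = f` and `div U = 0` pointwise on `E`
(Wang 2025, (0.1): `−Δu + u·∇u = −∇p`, `∇·u = 0` in `ℝ³`, the case `ν = 1`, `f = 0`; (0.5)₁,₂ for a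
viscosity `μ`; the stationary system goes back to Leray 1933, cf. Galdi 2011, Ch. X).  Here
`(U·∇)U = convect U U` and `div` is `VectorCalculus.divergence`.  No decay, integrability or
behaviour at infinity is built in (see `IsDSolution` and the module docstring); `C^∞` smoothness is
added by users as a separate hypothesis.  Field for field the case `a = 0` (with a force) of the
tree's `IsLerayProfile ν a U P`. [cite: Wang2025, (0.1) p. 1 and (0.5) p. 2] -/
structure IsSteadyNSSolution (ν : ℝ) (f U : E → E) (P : E → ℝ) : Prop where
  /-- The velocity is `C²`. -/
  contDiff_velocity : ContDiff ℝ 2 U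
  /-- The pressure is `C¹`. -/
  contDiff_pressure : ContDiff ℝ 1 P
  /-- The steady momentum equation `−νΔU + (U·∇)U + ∇P = f` holds pointwise. -/
  momentum : ∀ y, -(ν • (Δ U) y) + convect U U y + gradient P y = f y
  /-- Incompressibility `div U = 0`. -/
  divFree : VectorCalculus.IsDivFree U

namespace IsSteadyNSSolution

variable {ν : ℝ} {f U : E → E} {P : E → ℝ}

/-- The **trivial solution** `U = 0`, `P = 0` of the unforced steady system (Wang 2025, p. 1:
"`u = 0` is a solution"). [folklore] -/
protected theorem zero (ν : ℝ) : IsSteadyNSSolution ν 0 (0 : E → E) (0 : E → ℝ) where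
  contDiff_velocity := contDiff_const
  contDiff_pressure := contDiff_const
  momentum y := by simp [convect, Pi.zero_def, gradient]
  divFree y := by simp [VectorCalculus.divergence, Pi.zero_def]

/-- **Constant flows** `U ≡ a`, `P = 0` are unforced steady solutions. [folklore] -/
protected theorem const (ν : ℝ) (a : E) : IsSteadyNSSolution ν 0 (fun _ => a) (0 : E → ℝ) where
  contDiff_velocity := contDiff_const
  contDiff_pressure := contDiff_const
  momentum y := by simp [convect, Pi.zero_def, gradient]
  divFree y := by simp [VectorCalculus.divergence]

/-- **Linear shear flows** `U(y) = ⟪e, y⟫ v` with `⟪e, v⟫ = 0` (e.g. plane Couette flow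
`(x₂, 0, 0)`), `P = 0`, are nonzero unforced steady solutions for every viscosity: `ΔU = 0`,
`(U·∇)U = ⟪e, U⟫ v = ⟪e, y⟫⟪e, v⟫ v = 0`, `div U = ⟪e, v⟫ = 0` (non-vacuity of the notion). [folklore] -/
theorem shear (ν : ℝ) {e v : E} (hev : ⟪e, v⟫ = 0) :
    IsSteadyNSSolution ν 0 (fun y => ⟪e, y⟫ • v) (0 : E → ℝ) := by
  set b := stdOrthonormalBasis ℝ E
  set L : E →L[ℝ] E := (innerSL ℝ e).smulRight v with hL
  have hUL : (fun y => ⟪e, y⟫ • v) = L := by funext y; simp [hL]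
  have hD : fderiv ℝ (L : E → E) = fun _ => L := by funext z; exact L.fderiv
  rw [hUL]
  refine ⟨L.contDiff, contDiff_const, fun y => ?_, fun y => ?_⟩
  · have hΔ : (Δ (L : E → E)) y = 0 := by
      rw [InnerProductSpace.laplacian_eq_iteratedFDeriv_orthonormalBasis _ b]
      simp [iteratedFDeriv_two_apply, hD]
    rw [hΔ]
    simp [convect, Pi.zero_def, gradient, hL, hev]
  · rw [divergence_eq_sum_inner_fderiv b, L.fderiv]
    have hi : ∀ i, ⟪b i, L (b i)⟫ = ⟪e, b i⟫ * ⟪b i, v⟫ := fun i => by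
      simp [hL, inner_smul_right]
    simp_rw [hi, b.sum_inner_mul_inner, hev]

/-- **The force is determined by the flow**: two steady systems solved by the same `(U, P)` with
the same viscosity have the same force. [folklore] -/
theorem force_unique {g : E → E} (hf : IsSteadyNSSolution ν f U P)
    (hg : IsSteadyNSSolution ν g U P) : f = g :=
  funext fun y => (hf.momentum y).symm.trans (hg.momentum y)

/-- **Pressure normalisation**: the pressure is determined up to an additive constant —
`(U, P + p₀)` solves the same system (cf. Wang 2025, Thm 2.1 = Galdi 2011, Thm X.5.1, where the
pressure of a `D`-solution converges to a constant `p₁`). [folklore] -/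
theorem add_const (h : IsSteadyNSSolution ν f U P) (p₀ : ℝ) :
    IsSteadyNSSolution ν f U (fun y => P y + p₀) where
  contDiff_velocity := h.contDiff_velocity
  contDiff_pressure := h.contDiff_pressure.add contDiff_const
  momentum y := by
    have : gradient (fun y => P y + p₀) y = gradient P y := by
      rw [gradient, gradient, fderiv_add_const]
    rw [this, h.momentum y]
  divFree := h.divFree

/-- **Viscosity normalisation**: if `(U, P)` solves the steady system with viscosity `ν` and force
`f`, then `(κU, κ²P)` solves it with viscosity `κν` and force `κ²f` (every term is quadratic
under this substitution).  With `κ = ν⁻¹` this reduces viscosity `ν ≠ 0` to `ν = 1`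
(`IsSteadyNSSolution.viscosity_one`), the normalisation of Wang 2025, (0.1). [folklore] -/
theorem smul (h : IsSteadyNSSolution ν f U P) (κ : ℝ) :
    IsSteadyNSSolution (κ * ν) (κ ^ 2 • f) (κ • U) (κ ^ 2 • P) where
  contDiff_velocity := h.contDiff_velocity.const_smul κ
  contDiff_pressure := h.contDiff_pressure.const_smul (κ ^ 2)
  momentum y := by
    have hU2 : ContDiffAt ℝ 2 U y := h.contDiff_velocity.contDiffAt
    have hUd : DifferentiableAt ℝ U y := (h.contDiff_velocity.differentiable (by norm_num)) y
    have hPd : DifferentiableAt ℝ P y := (h.contDiff_pressure.differentiable one_ne_zero) y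
    have hΔ : (Δ (κ • U)) y = κ • (Δ U) y := InnerProductSpace.laplacian_smul κ hU2
    have hc : convect (κ • U) (κ • U) y = κ ^ 2 • convect U U y := by
      simp only [convect, Pi.smul_def, fderiv_fun_const_smul hUd, _root_.smul_apply, map_smul,
        smul_smul, pow_two]
    have hg : gradient (κ ^ 2 • P) y = κ ^ 2 • gradient P y := by
      have : (κ ^ 2 • P) = fun z => κ ^ 2 * P z := rfl
      rw [this, gradient_const_mul hPd]
    rw [hΔ, hc, hg, Pi.smul_apply, ← h.momentum y, smul_add, smul_add, smul_neg, smul_smul,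
      smul_smul]
    congr 3
    ring
  divFree y := by
    have hUd : DifferentiableAt ℝ U y := (h.contDiff_velocity.differentiable (by norm_num)) y
    have hD : fderiv ℝ (κ • U) y = κ • fderiv ℝ U y := fderiv_const_smul hUd κ
    have h0 := h.divFree y
    rw [VectorCalculus.divergence] at h0 ⊢
    rw [hD, ContinuousLinearMap.toLinearMap_smul, map_smul, h0, smul_zero]

/-- **Reduction to viscosity one**: for `ν ≠ 0`, `(U, P)` solves the steady system with
viscosity `ν` and force `f` iff `(ν⁻¹U, ν⁻²P)` solves it with viscosity `1` and force `ν⁻²f`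
(Wang 2025 states everything at `ν = 1`, (0.1)); this is the forward direction. [folklore] -/
theorem viscosity_one (h : IsSteadyNSSolution ν f U P) (hν : ν ≠ 0) :
    IsSteadyNSSolution 1 (ν⁻¹ ^ 2 • f) (ν⁻¹ • U) (ν⁻¹ ^ 2 • P) := by
  simpa [inv_mul_cancel₀ hν] using h.smul ν⁻¹

/-- **Navier–Stokes scaling of steady solutions (same viscosity).** If `(U, P)` solves the steady
system with viscosity `ν` and force `f`, then for every `c : ℝ` so does
`U_c(y) = c U(c y)`, `P_c(y) = c² P(c y)` with force `f_c(y) = c³ f(c y)`: by the chain rule every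
term of the equation for `(U_c, P_c)` at `y` is `c³` times the corresponding term for `(U, P)` at
`c y`, and `div U_c (y) = c² div U (c y)`.  The velocity scaling is letter for letter
`nsRescaleData c U` of `SelfSimilar.lean` (Leray's scaling at a fixed time); `c = 0` gives the
trivial solution.  A steady solution is thus a scale-free object. [folklore] -/
theorem rescale (h : IsSteadyNSSolution ν f U P) (c : ℝ) :
    IsSteadyNSSolution ν (fun y => c ^ 3 • f (c • y)) (fun y => c • U (c • y))
      (fun y => c ^ 2 * P (c • y)) where
  contDiff_velocity := (h.contDiff_velocity.comp (contDiff_const_smul c)).const_smul c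
  contDiff_pressure := contDiff_const.mul (h.contDiff_pressure.comp (contDiff_const_smul c))
  momentum y := by
    have hU := h.contDiff_velocity
    have hUd : Differentiable ℝ U := hU.differentiable (by norm_num)
    have hPd : Differentiable ℝ P := h.contDiff_pressure.differentiable one_ne_zero
    -- Laplacian: `Δ U_c (y) = c³ ΔU(c y)`
    have hc3 : c * c ^ 2 = c ^ 3 := by ring
    have hc3' : c ^ 2 * c = c ^ 3 := by ring
    have hUc : ContDiff ℝ 2 (fun y => U (c • y)) := hU.comp (contDiff_const_smul c)
    have hΔ : (Δ (fun y => c • U (c • y))) y = c ^ 3 • (Δ U) (c • y) := by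
      have h1 : (fun y => c • U (c • y)) = c • (fun y => U (c • y)) := rfl
      rw [h1, InnerProductSpace.laplacian_smul c hUc.contDiffAt, laplacian_comp_smul_right hU,
        smul_smul, hc3]
    -- convection: `(U_c·∇)U_c (y) = c³ (U·∇)U (c y)`
    have hc : convect (fun y => c • U (c • y)) (fun y => c • U (c • y)) y =
        c ^ 3 • convect U U (c • y) := by
      rw [convect, fderiv_rescale_velocity hUd, _root_.smul_apply, map_smul, smul_smul, convect, hc3']
    -- pressure gradient: `∇P_c (y) = c³ ∇P (c y)`
    have hPc : DifferentiableAt ℝ (fun y => P (c • y)) y :=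
      (hPd (c • y)).comp y (differentiableAt_id.const_smul c)
    have hg : gradient (fun y => c ^ 2 * P (c • y)) y = c ^ 3 • gradient P (c • y) := by
      rw [gradient_const_mul hPc, gradient_comp_smul_right, smul_smul, hc3']
    rw [hΔ, hc, hg, ← h.momentum (c • y), smul_add, smul_add, smul_neg, smul_comm ν]
  divFree y := by
    rw [divergence_rescale_velocity (h.contDiff_velocity.differentiable (by norm_num)),
      h.divFree (c • y), mul_zero]

/-- **Translation covariance**: `(U(· + a), P(· + a))` solves the steady system with force
`f(· + a)` (the equations have constant coefficients). [folklore] -/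
theorem comp_add_right (h : IsSteadyNSSolution ν f U P) (a : E) :
    IsSteadyNSSolution ν (fun y => f (y + a)) (fun y => U (y + a)) (fun y => P (y + a)) where
  contDiff_velocity := h.contDiff_velocity.comp ((contDiff_id).add contDiff_const)
  contDiff_pressure := h.contDiff_pressure.comp ((contDiff_id).add contDiff_const)
  momentum y := by
    have hc : convect (fun y => U (y + a)) (fun y => U (y + a)) y = convect U U (y + a) := by
      simp only [convect, fderiv_comp_add_right]
    rw [laplacian_comp_add_right', hc, gradient_comp_add_right', h.momentum (y + a)]
  divFree y := by rw [divergence_comp_add_right', h.divFree (y + a)]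

/-- **Rotation covariance** (Galilean invariance of the steady system under `x ↦ R x`,
`R ∈ O(E)`): `(R U R⁻¹, P ∘ R⁻¹)` solves the steady system with force `R f R⁻¹`
(`ΔU`, `(U·∇)U`, `∇P` are covariant and `div` is invariant; cf. Majda–Bertozzi, §1.2,
Prop. 1.1 (iii) for the time-dependent equations). [folklore] -/
theorem conj_linearIsometryEquiv (R : E ≃ₗᵢ[ℝ] E) (h : IsSteadyNSSolution ν f U P) :
    IsSteadyNSSolution ν (fun y => R (f (R.symm y))) (fun y => R (U (R.symm y)))
      (fun y => P (R.symm y)) where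
  contDiff_velocity := R.toContinuousLinearEquiv.contDiff.comp
    (h.contDiff_velocity.comp R.symm.toContinuousLinearEquiv.contDiff)
  contDiff_pressure := h.contDiff_pressure.comp R.symm.toContinuousLinearEquiv.contDiff
  momentum y := by
    have hc : convect (fun y => R (U (R.symm y))) (fun y => R (U (R.symm y))) y =
        R (convect U U (R.symm y)) := by
      simp [convect, fderiv_conj_isometry]
    rw [laplacian_conj_isometry, hc, gradient_comp_isometry_symm, ← R.map_smul, ← map_neg R,
      ← map_add R, ← map_add R, h.momentum (R.symm y)]
  divFree y := by rw [divergence_conj_isometry, h.divFree (R.symm y)]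

end IsSteadyNSSolution

/-! ### Leray's class `D` -/

section DSolution

variable [MeasurableSpace E] [BorelSpace E]

/-- **`D`-solutions (Leray's class `D`)** of the steady forced Navier–Stokes system with viscosity
`ν` on the whole space: a steady classical solution `(U, P)` (`IsSteadyNSSolution ν f U P`) with
FINITE DIRICHLET INTEGRAL `∫_E |∇U|² < ∞` (Wang 2025, (0.3); p. 2: Leray (1933) constructed
solutions "具有有限 Dirichlet 积分性质的解 (D-解)" — with finite Dirichlet integral, the `D`-solutions;
Galdi 2011, Ch. X).  The Dirichlet integral is the extended integral
`∫⁻ y, ENNReal.ofReal (frobeniusNormSq (fderiv ℝ U y))` of the pointwise dissipation density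
`|∇U(y)|² = ∑ᵢⱼ (∂ⱼUᵢ)²` (`frobeniusNormSq`) against Lebesgue measure (`volume`), literally the
expression used by the route items.  The limit at infinity (Wang 2025, (0.2) `u → 0`; (0.5)₄
`u → u₀`) is NOT part of the class: add `Tendsto U (cocompact E) (𝓝 U∞)` where needed. [cite: Wang2025, (0.3) p. 1 and p. 2] -/
def IsDSolution (ν : ℝ) (f U : E → E) (P : E → ℝ) : Prop :=
  IsSteadyNSSolution ν f U P ∧ (∫⁻ y, ENNReal.ofReal (frobeniusNormSq (fderiv ℝ U y))) < ∞

variable {ν : ℝ} {f U : E → E} {P : E → ℝ}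

/-- Unfolding `IsDSolution`. [folklore] -/
theorem isDSolution_iff : IsDSolution ν f U P ↔
    IsSteadyNSSolution ν f U P ∧ (∫⁻ y, ENNReal.ofReal (frobeniusNormSq (fderiv ℝ U y))) < ∞ :=
  Iff.rfl

/-- A `D`-solution is a steady solution. [folklore] -/
theorem IsDSolution.isSteadyNSSolution (h : IsDSolution ν f U P) : IsSteadyNSSolution ν f U P :=
  h.1

/-- A `D`-solution has finite Dirichlet integral `∫ |∇U|² < ∞` (Wang 2025, (0.3)). [folklore] -/
theorem IsDSolution.dirichlet_lt_top (h : IsDSolution ν f U P) :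
    (∫⁻ y, ENNReal.ofReal (frobeniusNormSq (fderiv ℝ U y))) < ∞ :=
  h.2

/-- The trivial solution is a `D`-solution (zero Dirichlet integral). [folklore] -/
protected theorem IsDSolution.zero (ν : ℝ) : IsDSolution ν 0 (0 : E → E) (0 : E → ℝ) :=
  ⟨IsSteadyNSSolution.zero ν, by simp [frobeniusNormSq]⟩

/-- Constant flows are `D`-solutions (zero Dirichlet integral) — with `a ≠ 0` they violate only the
decay condition `U → 0`, which is why the Liouville problem carries it (Wang 2025, (0.2)). [folklore] -/
protected theorem IsDSolution.const (ν : ℝ) (a : E) : IsDSolution ν 0 (fun _ => a) (0 : E → ℝ) :=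
  ⟨IsSteadyNSSolution.const ν a, by simp [frobeniusNormSq]⟩

/-- The shape of the full hypothesis block of the Liouville problem (Wang 2025, (0.1)–(0.3)),
witnessed nonvacuously by the trivial solution: a `D`-solution tending to `0` at infinity. [folklore] -/
theorem IsDSolution.zero_tendsto (ν : ℝ) :
    IsDSolution ν 0 (0 : E → E) (0 : E → ℝ) ∧ Tendsto (0 : E → E) (cocompact E) (𝓝 0) :=
  ⟨IsDSolution.zero ν, tendsto_const_nhds⟩

/-- `D`-solutions are translation covariant (Lebesgue measure is translation invariant). [folklore] -/
theorem IsDSolution.comp_add_right (h : IsDSolution ν f U P) (a : E) :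
    IsDSolution ν (fun y => f (y + a)) (fun y => U (y + a)) (fun y => P (y + a)) := by
  refine ⟨h.1.comp_add_right a, ?_⟩
  calc ∫⁻ y, ENNReal.ofReal (frobeniusNormSq (fderiv ℝ (fun y => U (y + a)) y))
      = ∫⁻ y, ENNReal.ofReal (frobeniusNormSq (fderiv ℝ U (y + a))) := by
        simp only [fderiv_comp_add_right]
    _ = ∫⁻ z, ENNReal.ofReal (frobeniusNormSq (fderiv ℝ U z)) :=
        lintegral_add_right_eq_self (μ := (volume : Measure E))
          (fun z => ENNReal.ofReal (frobeniusNormSq (fderiv ℝ U z))) a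
    _ < ∞ := h.2

/-- `D`-solutions are rotation covariant: `|∇(R U R⁻¹)(y)|² = |∇U(R⁻¹ y)|²` and `R⁻¹` preserves
Lebesgue measure. [folklore] -/
theorem IsDSolution.conj_linearIsometryEquiv (R : E ≃ₗᵢ[ℝ] E) (h : IsDSolution ν f U P) :
    IsDSolution ν (fun y => R (f (R.symm y))) (fun y => R (U (R.symm y)))
      (fun y => P (R.symm y)) := by
  refine ⟨h.1.conj_linearIsometryEquiv R, ?_⟩
  calc ∫⁻ y, ENNReal.ofReal (frobeniusNormSq (fderiv ℝ (fun y => R (U (R.symm y))) y))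
      = ∫⁻ y, ENNReal.ofReal (frobeniusNormSq (fderiv ℝ U (R.symm y))) := by
        simp only [fderiv_conj_isometry, frobeniusNormSq_conj_isometry]
    _ = ∫⁻ z, ENNReal.ofReal (frobeniusNormSq (fderiv ℝ U z)) :=
        R.symm.measurePreserving.lintegral_comp_emb R.symm.toMeasurableEquiv.measurableEmbedding
          (fun z => ENNReal.ofReal (frobeniusNormSq (fderiv ℝ U z)))
    _ < ∞ := h.2

/-- **Scaling of `D`-solutions**: for `c ≠ 0` the rescaled solution `(c U(c ·), c² P(c ·))` is again
a `D`-solution, since `|∇U_c(y)|² = c⁴ |∇U(c y)|²` and `dy = |c|^{-n} d(cy)`: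
`∫ |∇U_c|² = |c|^{4−n} ∫ |∇U|²` (`= |c| ∫|∇U|²` in `ℝ³`: the Dirichlet integral is NOT scale
invariant, the steady system is energy-supercritical). [folklore] -/
theorem IsDSolution.rescale (h : IsDSolution ν f U P) {c : ℝ} (hc : c ≠ 0) :
    IsDSolution ν (fun y => c ^ 3 • f (c • y)) (fun y => c • U (c • y))
      (fun y => c ^ 2 * P (c • y)) := by
  refine ⟨h.1.rescale c, ?_⟩
  have hUd : Differentiable ℝ U := h.1.contDiff_velocity.differentiable (by norm_num)
  set G : E → ℝ≥0∞ := fun z => ENNReal.ofReal (frobeniusNormSq (fderiv ℝ U z)) with hG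
  calc ∫⁻ y, ENNReal.ofReal (frobeniusNormSq (fderiv ℝ (fun y => c • U (c • y)) y))
      = ∫⁻ y, ENNReal.ofReal ((c ^ 2) ^ 2) * G (c • y) := by
        refine lintegral_congr fun y => ?_
        rw [fderiv_rescale_velocity hUd, frobeniusNormSq_smul', ENNReal.ofReal_mul (sq_nonneg _)]
    _ = ENNReal.ofReal ((c ^ 2) ^ 2) * ∫⁻ y, G (c • y) :=
        lintegral_const_mul' _ _ ENNReal.ofReal_ne_top
    _ = ENNReal.ofReal ((c ^ 2) ^ 2) * (ENNReal.ofReal |(c ^ finrank ℝ E)⁻¹| * ∫⁻ z, G z) := by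
        rw [lintegral_comp_smul' G hc]
    _ < ∞ := ENNReal.mul_lt_top ENNReal.ofReal_lt_top
        (ENNReal.mul_lt_top ENNReal.ofReal_lt_top h.2)

end DSolution

end Literature.Analysis.FluidPDE
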